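import Mathlib
import HarnessLib
import Summits.Ventures.LatticeQCDFlow.Scoring.CharFunArgumentContinuity

/-!
# A combination `aₙ·Uₙ − bₙ·Wₙ` of two INDEPENDENT asymptotically normal statistics with
# DETERMINISTIC, variance-normalised but otherwise arbitrary coefficients is asymptotically
# standard normal — the limit lemma for comparing two codes with unequal sample sizes

HONEST FRAMING: exact (Metropolis-corrected) sampling algorithms for lattice gauge theory;
figures of merit are autocorrelation/cost numbers at stated couplings and volumes; no
continuum-physics claim.

Venture `LatticeQCDFlow` (cell pub-lqcd), topic `Scoring`; FANOUT row 4 (`s0-u1-b`, rung S0-B: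
"A vs B within `1σ_comb`").  With sample sizes `n_A = n` and `n_B = mₙ → ∞` the difference of
the two printed columns, divided by its standard error, is `aₙ·Uₙ − bₙ·Wₙ` with
`Uₙ ⇒ N(0, s_A)`, `Wₙ ⇒ N(0, s_B)` independent and `s_A·aₙ² + s_B·bₙ² = 1`; the coefficients
depend on the free ratio `n/mₙ` and need not converge.  **`tendstoInDistribution_gaussianCombination`**:
such a combination converges in distribution to `N(0, 1)` — for every `t` its characteristic
function is `φ_{Uₙ}(aₙt)·φ_{Wₙ}(−bₙt)` and the arguments are bounded, so
`Scoring/CharFunArgumentContinuity` (`tendsto_charFun_map_sub_of_tendstoInDistribution`)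
replaces each factor by the Gaussian value, whose product is `e^{−t²/2}` identically in `n`.
Two deterministic companions used by the two-code test: convergence in distribution passes
to `n ↦ X_{mₙ}` for `mₙ → ∞` (**`tendstoInDistribution_comp_tendsto`**), and the pooled
variance ratio `(xₙpₙ + yₙqₙ)/(s_Apₙ + s_Bqₙ) → 1` for `xₙ → s_A > 0`, `yₙ → s_B > 0` and
nonnegative weights, WHATEVER the weights (**`tendsto_weightedRatio_one`**).  NEW WORK of the
cell; no definition; nothing cited as a fact.

## Content

* `abs_weightedRatio_sub_one_le`, **`tendsto_weightedRatio_one`**;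
* **`tendstoInDistribution_comp_tendsto`**;
* `charFun_gaussianReal_centred`, `tendstoInDistribution_gaussianCombination_of_forall`,
  **`tendstoInDistribution_gaussianCombination`** (normalisation only eventually).

NOT CLAIMED: random coefficients; more than two summands; non-Gaussian (stable) limits.
-/

noncomputable section

namespace Summit.Ventures.LatticeQCDFlow.Scoring.CardConsistency

open MeasureTheory ProbabilityTheory Filter Complex
open scoped Topology

/-! ## §1 Deterministic lemmas -/

section Deterministic

/-- `|(x·p + y·q)/(s_A·p + s_B·q) − 1| ≤ |x − s_A|/s_A + |y − s_B|/s_B` for `s_A, s_B > 0`,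
`p, q ≥ 0`, `p + q > 0`. [ours] -/
theorem abs_weightedRatio_sub_one_le {x y p q sA sB : ℝ} (hsA : 0 < sA) (hsB : 0 < sB)
    (hp : 0 ≤ p) (hq : 0 ≤ q) (hpq : 0 < p + q) :
    |(x * p + y * q) / (sA * p + sB * q) - 1| ≤ |x - sA| / sA + |y - sB| / sB := by
  have hD : 0 < sA * p + sB * q := by
    rcases lt_or_eq_of_le hp with hp' | hp'
    · exact add_pos_of_pos_of_nonneg (mul_pos hsA hp') (mul_nonneg hsB.le hq)
    · rw [← hp', mul_zero, zero_add]
      exact mul_pos hsB (by linarith)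
  rw [div_sub_one hD.ne', abs_div, abs_of_pos hD, div_le_iff₀ hD]
  have hnum : |x * p + y * q - (sA * p + sB * q)| ≤ |x - sA| * p + |y - sB| * q := by
    have e : x * p + y * q - (sA * p + sB * q) = (x - sA) * p + (y - sB) * q := by ring
    rw [e]
    refine (abs_add_le _ _).trans ?_
    rw [abs_mul, abs_mul, abs_of_nonneg hp, abs_of_nonneg hq]
  refine hnum.trans ?_
  rw [add_mul]
  have h1 : |x - sA| * p ≤ |x - sA| / sA * (sA * p + sB * q) := by
    rw [div_mul_eq_mul_div, le_div_iff₀ hsA]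
    nlinarith [abs_nonneg (x - sA), mul_nonneg hsB.le hq]
  have h2 : |y - sB| * q ≤ |y - sB| / sB * (sA * p + sB * q) := by
    rw [div_mul_eq_mul_div, le_div_iff₀ hsB]
    nlinarith [abs_nonneg (y - sB), mul_nonneg hsA.le hp]
  exact add_le_add h1 h2

/-- **The pooled-variance ratio tends to one whatever the weights**: `xₙ → s_A > 0`,
`yₙ → s_B > 0`, and eventually `pₙ, qₙ ≥ 0` with `pₙ + qₙ > 0` ⇒
`(xₙpₙ + yₙqₙ)/(s_Apₙ + s_Bqₙ) → 1`. [ours] -/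
theorem tendsto_weightedRatio_one {x y p q : ℕ → ℝ} {sA sB : ℝ} (hsA : 0 < sA) (hsB : 0 < sB)
    (hx : Tendsto x atTop (𝓝 sA)) (hy : Tendsto y atTop (𝓝 sB))
    (hpq : ∀ᶠ n in atTop, 0 ≤ p n ∧ 0 ≤ q n ∧ 0 < p n + q n) :
    Tendsto (fun n => (x n * p n + y n * q n) / (sA * p n + sB * q n)) atTop (𝓝 1) := by
  have hb : Tendsto (fun n => |x n - sA| / sA + |y n - sB| / sB) atTop (𝓝 0) := by
    have h1 : Tendsto (fun n => |x n - sA| / sA) atTop (𝓝 0) := by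
      have h := ((hx.sub_const sA).abs).div_const sA
      simpa using h
    have h2 : Tendsto (fun n => |y n - sB| / sB) atTop (𝓝 0) := by
      have h := ((hy.sub_const sB).abs).div_const sB
      simpa using h
    simpa using h1.add h2
  refine tendsto_sub_nhds_zero_iff.1 (squeeze_zero_norm' ?_ hb)
  filter_upwards [hpq] with n hn
  rw [Real.norm_eq_abs]
  exact abs_weightedRatio_sub_one_le hsA hsB hn.1 hn.2.1 hn.2.2

end Deterministic

/-! ## §2 Convergence in distribution along `mₙ → ∞` -/

section Subsequence

variable {Ω : Type*} [MeasurableSpace Ω] {P : Measure Ω} [IsProbabilityMeasure P]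
variable {Ω' : Type*} [MeasurableSpace Ω'] {P' : Measure Ω'} [IsProbabilityMeasure P']
variable {E : Type*} [TopologicalSpace E] [MeasurableSpace E] [OpensMeasurableSpace E]

/-- **`Xₙ ⇒ Z` and `mₙ → ∞` ⇒ `X_{mₙ} ⇒ Z`.** [ours] -/
theorem tendstoInDistribution_comp_tendsto {X : ℕ → Ω → E} {Z : Ω' → E}
    (hX : TendstoInDistribution X atTop Z (fun _ => P) P') {m : ℕ → ℕ}
    (hm : Tendsto m atTop atTop) :
    TendstoInDistribution (fun n => X (m n)) atTop Z (fun _ => P) P' where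
  forall_aemeasurable n := hX.forall_aemeasurable (m n)
  aemeasurable_limit := hX.aemeasurable_limit
  tendsto := hX.tendsto.comp hm

end Subsequence

/-! ## §3 The Gaussian combination lemma -/

section Combination

variable {Ω : Type*} [MeasurableSpace Ω] {P : Measure Ω} [IsProbabilityMeasure P]
variable {Ω' : Type*} [MeasurableSpace Ω'] {P' : Measure Ω'} [IsProbabilityMeasure P']

omit [IsProbabilityMeasure P'] in
/-- The characteristic function of a centred Gaussian law `N(0, s)`, `s ≥ 0`, read through a
variable: `φ(u) = e^{−s u²/2}`. [folklore] (Mathlib's `charFun_gaussianReal`) -/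
theorem charFun_gaussianReal_centred {Y : Ω' → ℝ} {s : ℝ} (hs : 0 ≤ s)
    (hY : HasLaw Y (gaussianReal 0 s.toNNReal) P') (u : ℝ) :
    charFun (P'.map Y) u = cexp (((-(s * u ^ 2 / 2) : ℝ) : ℂ)) := by
  rw [hY.map_eq, charFun_gaussianReal]
  congr 1
  push_cast
  rw [Real.coe_toNNReal _ hs]
  ring

/-- **THE GAUSSIAN COMBINATION LEMMA (normalisation at every `n`).**  Real statistics
`Uₙ ⇒ Z_A ∼ N(0, s_A)` and `Wₙ ⇒ Z_B ∼ N(0, s_B)` with `s_A, s_B > 0` and `Uₙ ⟂ Wₙ` for every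
`n`; DETERMINISTIC coefficients `aₙ, bₙ` with `s_A·aₙ² + s_B·bₙ² = 1` for every `n` (bounded,
but no convergence is assumed); `Z ∼ N(0, 1)` any standard normal variable.  Then
`aₙ·Uₙ − bₙ·Wₙ ⇒ Z`. [ours] (characteristic functions: `φ_{Uₙ}(aₙt)·φ_{Wₙ}(−bₙt)`, each
factor within `o(1)` of the Gaussian value uniformly along the bounded arguments by
`tendsto_charFun_map_sub_of_tendstoInDistribution`, and
`e^{−s_A aₙ²t²/2}·e^{−s_B bₙ²t²/2} = e^{−t²/2}`) -/
theorem tendstoInDistribution_gaussianCombination_of_forall {U W : ℕ → Ω → ℝ}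
    {ZA ZB Z : Ω' → ℝ}
    {sA sB : ℝ} (hsA : 0 < sA) (hsB : 0 < sB)
    (hU : TendstoInDistribution U atTop ZA (fun _ => P) P')
    (hZA : HasLaw ZA (gaussianReal 0 sA.toNNReal) P')
    (hW : TendstoInDistribution W atTop ZB (fun _ => P) P')
    (hZB : HasLaw ZB (gaussianReal 0 sB.toNNReal) P') (hUW : ∀ n, IndepFun (U n) (W n) P)
    {α β : ℕ → ℝ} (hαβ : ∀ n, sA * α n ^ 2 + sB * β n ^ 2 = 1)
    (hZ : HasLaw Z (gaussianReal 0 1) P') :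
    TendstoInDistribution (fun n ω => α n * U n ω - β n * W n ω) atTop Z (fun _ => P) P' where
  forall_aemeasurable n :=
    ((hU.forall_aemeasurable n).const_mul (α n)).sub ((hW.forall_aemeasurable n).const_mul (β n))
  aemeasurable_limit := hZ.aemeasurable
  tendsto := by
    rw [ProbabilityMeasure.tendsto_iff_tendsto_charFun]
    intro t
    simp only [ProbabilityMeasure.coe_mk]
    -- the arguments `aₙt`, `−bₙt` are bounded
    have hαb : ∀ n, |α n * t| ≤ Real.sqrt sA⁻¹ * |t| := by
      intro n
      rw [abs_mul]
      refine mul_le_mul_of_nonneg_right (Real.abs_le_sqrt ?_) (abs_nonneg t)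
      rw [inv_eq_one_div, le_div_iff₀ hsA]
      nlinarith [hαβ n, mul_nonneg hsB.le (sq_nonneg (β n))]
    have hβb : ∀ n, |-β n * t| ≤ Real.sqrt sB⁻¹ * |t| := by
      intro n
      rw [abs_mul, abs_neg]
      refine mul_le_mul_of_nonneg_right (Real.abs_le_sqrt ?_) (abs_nonneg t)
      rw [inv_eq_one_div, le_div_iff₀ hsB]
      nlinarith [hαβ n, mul_nonneg hsA.le (sq_nonneg (α n))]
    -- the characteristic function factors by independence
    have hfac : ∀ n, charFun (P.map fun ω => α n * U n ω - β n * W n ω) t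
        = charFun (P.map (U n)) (α n * t) * charFun (P.map (W n)) (-β n * t) := by
      intro n
      have hind : IndepFun (fun ω => α n * U n ω) (fun ω => -β n * W n ω) P :=
        (hUW n).comp (measurable_const_mul _) (measurable_const_mul _)
      have e : (fun ω => α n * U n ω - β n * W n ω)
          = fun ω => α n * U n ω + -β n * W n ω := by
        funext ω
        ring
      rw [e, hind.charFun_map_fun_add_eq_mul ((hU.forall_aemeasurable n).const_mul _)
        ((hW.forall_aemeasurable n).const_mul _), Pi.mul_apply,
        charFun_map_mul_comp (hU.forall_aemeasurable n),
        charFun_map_mul_comp (hW.forall_aemeasurable n)]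
    -- the Gaussian values multiply to the target, identically in `n`
    have htarget : charFun (P'.map Z) t = cexp (((-(t ^ 2 / 2) : ℝ) : ℂ)) := by
      rw [hZ.map_eq, charFun_gaussianReal]
      congr 1
      push_cast
      ring
    have hprod : ∀ n, charFun (P'.map ZA) (α n * t) * charFun (P'.map ZB) (-β n * t)
        = charFun (P'.map Z) t := by
      intro n
      rw [charFun_gaussianReal_centred hsA.le hZA, charFun_gaussianReal_centred hsB.le hZB,
        htarget, ← Complex.exp_add]
      congr 1
      have h1 : (sA : ℂ) * (α n : ℂ) ^ 2 + (sB : ℂ) * (β n : ℂ) ^ 2 = 1 := by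
        exact_mod_cast hαβ n
      push_cast
      linear_combination (-(t : ℂ) ^ 2 / 2) * h1
    -- each factor is within `o(1)` of its Gaussian value along the bounded arguments
    have hdA := tendsto_charFun_map_sub_of_tendstoInDistribution hU hαb
    have hdB := tendsto_charFun_map_sub_of_tendstoInDistribution hW hβb
    have hkey : ∀ n, charFun (P.map fun ω => α n * U n ω - β n * W n ω) t - charFun (P'.map Z) t
        = (charFun (P.map (U n)) (α n * t) - charFun (P'.map ZA) (α n * t))
            * charFun (P.map (W n)) (-β n * t)
          + charFun (P'.map ZA) (α n * t)
            * (charFun (P.map (W n)) (-β n * t) - charFun (P'.map ZB) (-β n * t)) := by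
      intro n
      rw [hfac n, ← hprod n]
      ring
    have h1 : Tendsto (fun n => (charFun (P.map (U n)) (α n * t) - charFun (P'.map ZA) (α n * t))
        * charFun (P.map (W n)) (-β n * t)) atTop (𝓝 0) := by
      refine hdA.zero_mul_isBoundedUnder_le (isBoundedUnder_of ⟨1, fun n => ?_⟩)
      haveI := Measure.isProbabilityMeasure_map (hW.forall_aemeasurable n) (μ := P)
      exact norm_charFun_le_one _
    have h2 : Tendsto (fun n => charFun (P'.map ZA) (α n * t)
        * (charFun (P.map (W n)) (-β n * t) - charFun (P'.map ZB) (-β n * t))) atTop (𝓝 0) := by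
      refine isBoundedUnder_le_mul_tendsto_zero (isBoundedUnder_of ⟨1, fun n => ?_⟩) hdB
      haveI := Measure.isProbabilityMeasure_map hZA.aemeasurable (μ := P')
      exact norm_charFun_le_one _
    refine tendsto_sub_nhds_zero_iff.1 ?_
    have h12 := h1.add h2
    rw [add_zero] at h12
    exact h12.congr fun n => (hkey n).symm

/-- **THE GAUSSIAN COMBINATION LEMMA.**  As `tendstoInDistribution_gaussianCombination_of_forall`,
with the normalisation `s_A·aₙ² + s_B·bₙ² = 1` required only EVENTUALLY (sample-size formulas
are junk at `n = 0`): `aₙ·Uₙ − bₙ·Wₙ ⇒ Z ∼ N(0, 1)`. [ours] (repair the coefficients at the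
finitely many bad indices; the laws agree eventually) -/
theorem tendstoInDistribution_gaussianCombination {U W : ℕ → Ω → ℝ} {ZA ZB Z : Ω' → ℝ}
    {sA sB : ℝ} (hsA : 0 < sA) (hsB : 0 < sB)
    (hU : TendstoInDistribution U atTop ZA (fun _ => P) P')
    (hZA : HasLaw ZA (gaussianReal 0 sA.toNNReal) P')
    (hW : TendstoInDistribution W atTop ZB (fun _ => P) P')
    (hZB : HasLaw ZB (gaussianReal 0 sB.toNNReal) P') (hUW : ∀ n, IndepFun (U n) (W n) P)
    {α β : ℕ → ℝ} (hαβ : ∀ᶠ n in atTop, sA * α n ^ 2 + sB * β n ^ 2 = 1)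
    (hZ : HasLaw Z (gaussianReal 0 1) P') :
    TendstoInDistribution (fun n ω => α n * U n ω - β n * W n ω) atTop Z (fun _ => P) P' := by
  classical
  -- repaired coefficients, normalised at EVERY index
  set α' : ℕ → ℝ := fun n => if sA * α n ^ 2 + sB * β n ^ 2 = 1 then α n else Real.sqrt sA⁻¹
    with hα'
  set β' : ℕ → ℝ := fun n => if sA * α n ^ 2 + sB * β n ^ 2 = 1 then β n else 0 with hβ'
  have hαβ' : ∀ n, sA * α' n ^ 2 + sB * β' n ^ 2 = 1 := by
    intro n
    by_cases hn : sA * α n ^ 2 + sB * β n ^ 2 = 1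
    · simp only [hα', hβ', if_pos hn, hn]
    · simp only [hα', hβ', if_neg hn]
      rw [Real.sq_sqrt (inv_nonneg.2 hsA.le), mul_inv_cancel₀ hsA.ne']
      ring
  have h' := tendstoInDistribution_gaussianCombination_of_forall hsA hsB hU hZA hW hZB hUW hαβ' hZ
  refine ⟨fun n => ((hU.forall_aemeasurable n).const_mul (α n)).sub
    ((hW.forall_aemeasurable n).const_mul (β n)), hZ.aemeasurable, ?_⟩
  refine h'.tendsto.congr' ?_
  filter_upwards [hαβ] with n hn
  have hαn : α' n = α n := by simp only [hα', if_pos hn]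
  have hβn : β' n = β n := by simp only [hβ', if_pos hn]
  apply Subtype.ext
  simp only [hαn, hβn]

end Combination

end Summit.Ventures.LatticeQCDFlow.Scoring.CardConsistency

end
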